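import Literature.NumberTheory.Automorphic.TorusLieDual
import Literature.NumberTheory.Automorphic.TorusRigidity
import HarnessLib

/-!
# A torus is determined by its Lie algebra inside a diagonalisable group (characteristic `0`)
(trunk T-AUTOMORPHIC, G25 AutomorphicL; tool for the graph proof of `chevalley_isomorphism(_abstract)`,
Springer 9.6.2; Springer 3.2.10 (4), 4.4.13)

Over an algebraically closed field of characteristic `0`:

* **`eq_one_of_forall_dChar_eq_zero`** — a character of a torus `S` with zero differential on
  `Lie(S)` is trivial (`X*(S)` is free, `exists_dualBases_of_isTorusSubgroup`, so a non-trivial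
  character has a coordinate functional `ℓ : X*(S) → ℤ → k` not vanishing on it, and
  `ℓ = (χ ↦ dχ (H))` for some `H ∈ Lie(S)` by the duality `Lie(S) ≅ Hom(X*(S), k)`,
  `lieTorusDual_bijective`);
* **`le_of_lieAlgebraGL_le_of_le_diagonal`** — for a torus `S` and a closed subgroup `T` of the
  diagonal group with `Lie(S) ⊆ Lie(T)` one has `S ⊆ T`: a monomial character `t^a` trivial on
  `T` has differential `H ↦ ∑ aᵢ Hᵢᵢ` (`dChar_diagChar`) vanishing on `Lie(T) ⊇ Lie(S)`, so
  `t^a|_S = 1`, and `T` is cut out by its trivial monomial characters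
  (`diagonalGL_mem_of_forall_diagChar`, Springer 3.2.10 (4));
* **`le_of_lieAlgebraGL_le`** — the same for `S`, `T` inside any commutative subgroup of
  semisimple matrices (simultaneous diagonalisation `exists_conj_le_diagonalSubgroup` and transport
  along `Int(g)`, `TorusRigidity.lean`, `TorusLieDual.lean`).

Everything is proved; no named fact is introduced.

## References

* [SpringerLAG1998] T. A. Springer, *Linear Algebraic Groups*, 2nd ed. (1998), 3.2.10 (4), 4.4.13.
-/

noncomputable section

open scoped MatrixGroups

namespace Literature.NumberTheory.Automorphic

variable {k : Type*} [Field k] [IsAlgClosed k] [CharZero k] {n : Type*} [Fintype n] [DecidableEq n]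

/-- **A character of a torus with zero differential is trivial** (characteristic `0`).
[cite: SpringerLAG1998, 4.4.13] -/
theorem eq_one_of_forall_dChar_eq_zero {S : Subgroup (GL n k)} (hS : IsTorusSubgroup S)
    (χ : ↥(characterLattice S)) (h : ∀ H ∈ lieAlgebraGL S, dChar χ H = 0) : χ = 1 := by
  haveI : IsMulCommutative ↥S := hS.2.1
  by_contra hne
  obtain ⟨r, bX, -, -⟩ := exists_dualBases_of_isTorusSubgroup hS
  have hx : bX (Additive.ofMul χ) ≠ 0 := by
    intro h0
    apply hne
    have : Additive.ofMul χ = 0 := bX.injective (by rw [h0, map_zero])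
    exact Additive.ofMul.injective this
  obtain ⟨i, hi⟩ : ∃ i, bX (Additive.ofMul χ) i ≠ 0 := by
    by_contra hall
    push Not at hall
    exact hx (funext hall)
  -- the coordinate functional `x ↦ (bX x)ᵢ ∈ k`
  let ℓ : Additive ↥(characterLattice S) →+ k :=
    (Int.castAddHom k).comp ((Pi.evalAddMonoidHom (fun _ : Fin r => ℤ) i).comp bX.toAddMonoidHom)
  obtain ⟨H, hH⟩ := (lieTorusDual_bijective hS).2 ℓ
  have h1 : dChar χ (H : Matrix n n k) = ℓ (Additive.ofMul χ) := by
    have e := DFunLike.congr_fun hH (Additive.ofMul χ)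
    rw [lieTorusDual_apply] at e
    exact e
  have h2 : ℓ (Additive.ofMul χ) = ((bX (Additive.ofMul χ) i : ℤ) : k) := rfl
  rw [h H H.2, h2] at h1
  exact hi (by exact_mod_cast h1.symm)

/-- **Inside the diagonal group, a torus lies in every closed subgroup containing its Lie algebra's
worth of directions**: `Lie(S) ⊆ Lie(T) ⇒ S ⊆ T` for a torus `S ≤ 𝔻ₙ` and a closed `T ≤ 𝔻ₙ`.
[cite: SpringerLAG1998, 3.2.10 (4)] -/
theorem le_of_lieAlgebraGL_le_of_le_diagonal {S T : Subgroup (GL n k)} (hS : IsTorusSubgroup S)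
    (hSd : S ≤ diagonalSubgroup n k) (hTalg : IsAlgebraicSubgroup T) (hTd : T ≤ diagonalSubgroup n k)
    (hle : lieAlgebraGL S ≤ lieAlgebraGL T) : S ≤ T := by
  haveI : IsMulCommutative ↥S := hS.2.1
  intro s hs
  have hsd : diagonalGL n k (diagCoord hSd ⟨s, hs⟩) = s := diagonalGL_diagCoord hSd ⟨s, hs⟩
  rw [← hsd]
  refine diagonalGL_mem_of_forall_diagChar hTalg hTd _ fun a ha => ?_
  -- the monomial character `t^a` is trivial on `T`, hence has zero differential on `Lie(T) ⊇ Lie(S)`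
  have hχ : (Additive.toMul (weightHom hSd a) : ↥(characterLattice S)) = 1 := by
    refine eq_one_of_forall_dChar_eq_zero hS _ fun H hH => ?_
    rw [dChar_diagChar hSd a hH]
    have hT1 : (Additive.toMul (weightHom hTd a) : ↥(characterLattice T)) = 1 := by
      apply Subtype.ext
      rw [coe_weightHom, ha]
      rfl
    have h0 := dChar_diagChar hTd a (hle hH)
    rw [hT1, dChar_one (hle hH)] at h0
    exact h0.symm
  have h := congrArg (fun χ : ↥(characterLattice S) => ((χ : ↥S →* kˣ) ⟨s, hs⟩ : kˣ)) hχ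
  simp only [coe_weightHom, diagChar_apply, OneMemClass.coe_one, MonoidHom.one_apply] at h
  exact h

/-- **A torus lies in a closed subgroup of a commutative group of semisimple matrices as soon as
its Lie algebra does**: for `S`, `T ≤ 𝕋` with `𝕋` commutative and consisting of semisimple elements,
`S` a torus, `T` closed and `Lie(S) ⊆ Lie(T)`, one has `S ⊆ T`. [cite: SpringerLAG1998, 3.2.10 (4)] -/
theorem le_of_lieAlgebraGL_le {S T D : Subgroup (GL n k)} (hDcomm : IsMulCommutative ↥D)
    (hDss : ∀ t ∈ D, IsSemisimpleElt t) (hSD : S ≤ D) (hTD : T ≤ D) (hS : IsTorusSubgroup S)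
    (hTalg : IsAlgebraicSubgroup T) (hle : lieAlgebraGL S ≤ lieAlgebraGL T) : S ≤ T := by
  obtain ⟨g, hg⟩ := exists_conj_le_diagonalSubgroup hDcomm hDss
  rw [MulEquiv.toMonoidHom_eq_coe] at hg
  set c : GL n k →* GL n k := (MulAut.conj g : GL n k →* GL n k) with hc
  have hS' : IsTorusSubgroup (S.map c) := hS.map_conj g
  have hT' : IsAlgebraicSubgroup (T.map c) := hTalg.map_conj' g
  have hSd : S.map c ≤ diagonalSubgroup n k := (Subgroup.map_mono hSD).trans hg
  have hTd : T.map c ≤ diagonalSubgroup n k := (Subgroup.map_mono hTD).trans hg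
  have hle' : lieAlgebraGL (S.map c) ≤ lieAlgebraGL (T.map c) := by
    intro A hA
    have h1 := inv_conj_mem_lieAlgebraGL_of_mem_map_conj g hA
    have h2 := (mem_lieAlgebraGL_map_conj_iff (T := T) g).2 (hle h1)
    rwa [units_conj_inv_conj] at h2
  have hST := le_of_lieAlgebraGL_le_of_le_diagonal hS' hSd hT' hTd hle'
  intro s hs
  have : c s ∈ T.map c := hST (Subgroup.mem_map_of_mem c hs)
  obtain ⟨t, ht, hts⟩ := Subgroup.mem_map.1 this
  have : t = s := (MulAut.conj g).injective hts
  rwa [this] at ht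

end Literature.NumberTheory.Automorphic
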